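import Literature.AlgebraicGeometry.Motives.MixedHodgeStructureTransport
import Literature.AlgebraicGeometry.Motives.MixedHodgeStructureTensorHodgeNumbers
import Literature.AlgebraicGeometry.Motives.MixedHodgeStructureTensorMorphisms
import Literature.AlgebraicGeometry.Motives.MixedHodgeStructureDualHodgeNumbers
import Literature.AlgebraicGeometry.Motives.MixedHodgeStructureDualSubobjects
import Mathlib.LinearAlgebra.Contraction
import HarnessLib

/-!
# The internal Hom `Hom(H₁, H₂) = H₁^∨ ⊗ H₂` of mixed Hodge structures

For mixed `ℚ`-Hodge structures `H₁` on `V` and `H₂` on `V'` (finite-dimensional), the **internal Hom**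
is the MHS on `V →ₗ[ℚ] V'` obtained by transporting the tensor product `H₁^∨ ⊗ H₂`
(`MixedHodgeStructure.tensor`, `MixedHodgeStructure.dual`; Cattani–El Zein–Griffiths–Lê §3.2.2.7
(1): "The MHS … Hom(H, H') [is] defined by applying the general rules of filtrations", Deligne,
*Hodge II*, 1.1.12: `Hom(A, B) = A^∨ ⊗ B` for filtered objects of finite type) along the canonical
isomorphism `V^∨ ⊗ V' ≅ Hom(V, V')` (Mathlib's `dualTensorHomEquiv`, `φ ⊗ w ↦ (v ↦ φ(v) w)`), by the
tree's transport `MixedHodgeStructure.comapEquiv` (`Motives/MixedHodgeStructureTransport`).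

## Main results (definitions with bodies and theorems; no named facts)

* **`MixedHodgeStructure.hom H₁ H₂ : MixedHodgeStructure (V →ₗ[ℚ] V')`**, `hom_W`, `hom_F`;
* `homToTensor : Hom (hom H₁ H₂) (H₁^∨ ⊗ H₂)` and `tensorToHom` — mutually inverse isomorphisms of
  MHS, `tensorToHom_apply_tmul` (`φ ⊗ w ↦ (v ↦ φ(v) • w)`);
* **`hodgeNumber_hom`**: `h^{p,q}(Hom(H₁,H₂)) = Σ_{a,b} h^{-a,-b}(H₁) · h^{p-a,q-b}(H₂)`;
* `IsPure.hom` (`Hom` of pure structures of weights `n`, `m` is pure of weight `m - n`),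
  `hom_tateTwist_right` (`Hom(H₁, H₂(j)) = Hom(H₁,H₂)(j)`), `hom_tateTwist_left`
  (`Hom(H₁(j), H₂) = Hom(H₁,H₂)(-j)`).

The identification of the transported filtrations with `{f | f(W_i) ⊆ W_{i+r}}`,
`{f | f(F^a) ⊆ F^{a+p}}` (Deligne 1.1.5) is not formalised here. -- TODO(general form)

## References

* [CattaniElZeinGriffithsLe2014] E. Cattani et al. (eds.), *Hodge Theory* (2014), §3.2.2.7 (1)–(3).
* [DeligneHodgeII1971] P. Deligne, Théorie de Hodge II, 1.1.5, 1.1.12, 2.1.13.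
-/

noncomputable section

open scoped TensorProduct

namespace Literature.AlgebraicGeometry.Motives

namespace MixedHodgeStructure

universe u v

variable {V : Type u} [AddCommGroup V] [Module ℚ V]
variable {V' : Type v} [AddCommGroup V'] [Module ℚ V']

open Module

variable [FiniteDimensional ℚ V] [FiniteDimensional ℚ V'] (H₁ : MixedHodgeStructure V)
  (H₂ : MixedHodgeStructure V')

/-- **The internal Hom `Hom(H₁, H₂)`**: the MHS on `V →ₗ[ℚ] V'` transported from `H₁^∨ ⊗ H₂` along
`V^∨ ⊗ V' ≅ Hom(V, V')` (Cattani et al. §3.2.2.7 (1); Deligne 1.1.12).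
[cite: CattaniElZeinGriffithsLe2014, §3.2.2.7] -/
def hom : MixedHodgeStructure (V →ₗ[ℚ] V') :=
  (tensor H₁.dual H₂).comapEquiv (dualTensorHomEquiv ℚ V V').symm

/-- `W_k Hom(H₁,H₂)` is the pull-back of `W_k(H₁^∨ ⊗ H₂)` along `Hom(V,V') ≅ V^∨ ⊗ V'`.
[cite: CattaniElZeinGriffithsLe2014, §3.2.2.7] -/
theorem hom_W (k : ℤ) :
    (hom H₁ H₂).W k = ((tensor H₁.dual H₂).W k).comap
      ((dualTensorHomEquiv ℚ V V').symm : (V →ₗ[ℚ] V') →ₗ[ℚ] Module.Dual ℚ V ⊗[ℚ] V') :=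
  rfl

/-- `F^p Hom(H₁,H₂)_ℂ` is the pull-back of `F^p(H₁^∨ ⊗ H₂)_ℂ` along the complexified
`Hom(V,V') ≅ V^∨ ⊗ V'`. [cite: CattaniElZeinGriffithsLe2014, §3.2.2.7] -/
theorem hom_F (p : ℤ) :
    (hom H₁ H₂).F p = ((tensor H₁.dual H₂).F p).comap
      (((dualTensorHomEquiv ℚ V V').symm :
        (V →ₗ[ℚ] V') →ₗ[ℚ] Module.Dual ℚ V ⊗[ℚ] V').baseChange ℂ) :=
  rfl

/-! ### `Hom(H₁, H₂) ≅ H₁^∨ ⊗ H₂` -/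

/-- The isomorphism of MHS `Hom(H₁,H₂) → H₁^∨ ⊗ H₂` (underlying `dualTensorHomEquiv.symm`).
[cite: CattaniElZeinGriffithsLe2014, §3.2.2.7] -/
def homToTensor : Hom (hom H₁ H₂) (tensor H₁.dual H₂) :=
  Hom.ofEquiv _ _

/-- The isomorphism of MHS `H₁^∨ ⊗ H₂ → Hom(H₁,H₂)`, `φ ⊗ w ↦ (v ↦ φ(v) w)` (underlying
`dualTensorHomEquiv`). [cite: CattaniElZeinGriffithsLe2014, §3.2.2.7] -/
def tensorToHom : Hom (tensor H₁.dual H₂) (hom H₁ H₂) :=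
  Hom.ofEquivSymm _ _

/-- The underlying map of `homToTensor`. [cite: CattaniElZeinGriffithsLe2014, §3.2.2.7] -/
@[simp]
theorem homToTensor_toLinearMap :
    (homToTensor H₁ H₂).toLinearMap =
      ((dualTensorHomEquiv ℚ V V').symm : (V →ₗ[ℚ] V') →ₗ[ℚ] Module.Dual ℚ V ⊗[ℚ] V') :=
  rfl

/-- The underlying map of `tensorToHom`. [cite: CattaniElZeinGriffithsLe2014, §3.2.2.7] -/
@[simp]
theorem tensorToHom_toLinearMap :
    (tensorToHom H₁ H₂).toLinearMap =
      (dualTensorHomEquiv ℚ V V' : Module.Dual ℚ V ⊗[ℚ] V' →ₗ[ℚ] (V →ₗ[ℚ] V')) :=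
  rfl

/-- `tensorToHom (φ ⊗ w) = (v ↦ φ(v) • w)`. [cite: CattaniElZeinGriffithsLe2014, §3.2.2.7] -/
theorem tensorToHom_apply_tmul (φ : Module.Dual ℚ V) (w : V') (v : V) :
    (tensorToHom H₁ H₂).toLinearMap (φ ⊗ₜ[ℚ] w) v = φ v • w := by
  rw [tensorToHom_toLinearMap, LinearEquiv.coe_coe, dualTensorHomEquiv, dualTensorHomEquivOfBasis_apply,
    dualTensorHom_apply]

/-- `tensorToHom ∘ homToTensor = id`. [cite: CattaniElZeinGriffithsLe2014, §3.2.2.7] -/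
theorem tensorToHom_comp_homToTensor :
    (tensorToHom H₁ H₂).comp (homToTensor H₁ H₂) = Hom.id (hom H₁ H₂) :=
  Hom.ofEquivSymm_comp_ofEquiv _ _

/-- `homToTensor ∘ tensorToHom = id`. [cite: CattaniElZeinGriffithsLe2014, §3.2.2.7] -/
theorem homToTensor_comp_tensorToHom :
    (homToTensor H₁ H₂).comp (tensorToHom H₁ H₂) = Hom.id (tensor H₁.dual H₂) :=
  Hom.ofEquiv_comp_ofEquivSymm _ _

/-- `Hom(H₁,H₂) ≅ H₁^∨ ⊗ H₂` is bijective. [cite: CattaniElZeinGriffithsLe2014, §3.2.2.7] -/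
theorem homToTensor_bijective : Function.Bijective (homToTensor H₁ H₂).toLinearMap :=
  Hom.ofEquiv_bijective _ _

/-- `H₁^∨ ⊗ H₂ ≅ Hom(H₁,H₂)` is bijective. [cite: CattaniElZeinGriffithsLe2014, §3.2.2.7] -/
theorem tensorToHom_bijective : Function.Bijective (tensorToHom H₁ H₂).toLinearMap :=
  Hom.ofEquivSymm_bijective _ _

/-! ### Hodge numbers, weights, twists -/

/-- **Hodge numbers of the internal Hom**:
`h^{p,q}(Hom(H₁,H₂)) = Σ_{a,b} h^{-a,-b}(H₁) · h^{p-a,q-b}(H₂)` (transport preserves Hodge numbers;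
`h^{p,q}(H₁^∨ ⊗ H₂) = Σ h^{a,b}(H₁^∨) h^{p-a,q-b}(H₂)` and `h^{a,b}(H^∨) = h^{-a,-b}(H)`).
[cite: CattaniElZeinGriffithsLe2014, §3.2.2.7] -/
theorem hodgeNumber_hom (p q : ℤ) :
    (hom H₁ H₂).hodgeNumber p q =
      ∑ᶠ (a : ℤ) (b : ℤ), H₁.hodgeNumber (-a) (-b) * H₂.hodgeNumber (p - a) (q - b) := by
  rw [hom, hodgeNumber_comapEquiv, hodgeNumber_tensor]
  simp_rw [hodgeNumber_dual]

/-- **`Hom` of pure structures is pure**: if `H₁` is pure of weight `n` and `H₂` pure of weight `m`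
then `Hom(H₁,H₂)` is pure of weight `m - n`. [cite: CattaniElZeinGriffithsLe2014, §3.2.2.7] -/
theorem IsPure.hom {H₁ : MixedHodgeStructure V} {H₂ : MixedHodgeStructure V'} {n m : ℤ}
    (h₁ : H₁.IsPure n) (h₂ : H₂.IsPure m) : (hom H₁ H₂).IsPure (m - n) := by
  rw [show m - n = -n + m by ring]
  exact (((isPure_dual_iff H₁ n).2 h₁).tensor h₂).comapEquiv _

/-- **`Hom(H₁, H₂(j)) = Hom(H₁, H₂)(j)`** (as MHS on `V →ₗ[ℚ] V'`).
[cite: CattaniElZeinGriffithsLe2014, §3.2.2.7] -/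
theorem hom_tateTwist_right (j : ℤ) : hom H₁ (H₂.tateTwist j) = (hom H₁ H₂).tateTwist j := by
  unfold hom
  rw [tensor_tateTwist_right, comapEquiv_tateTwist]

/-- **`Hom(H₁(j), H₂) = Hom(H₁, H₂)(-j)`** (`(H₁(j))^∨ = H₁^∨(-j)`).
[cite: CattaniElZeinGriffithsLe2014, §3.2.2.7] -/
theorem hom_tateTwist_left (j : ℤ) : hom (H₁.tateTwist j) H₂ = (hom H₁ H₂).tateTwist (-j) := by
  unfold hom
  rw [dual_tateTwist, tensor_tateTwist_left, comapEquiv_tateTwist]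

end MixedHodgeStructure

end Literature.AlgebraicGeometry.Motives

end
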